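import Literature.MathematicalPhysics.QuantumFieldTheory.Balaban1983to89.B15Prop1Thm1RowsOfExistsUnique
import Literature.MathematicalPhysics.QuantumFieldTheory.Balaban1983to89.B11Thm1ExistsUniqueTokensGBBridges
import Summits.QuantumFields.YangMills.Theorems.BalabanUVNodesN07Thm1Top7FromProp8GuardedB
import Summits.QuantumFields.YangMills.Theorems.BalabanUVNodesN07RecordDomainsAdm22
import Literature.MathematicalPhysics.QuantumFieldTheory.Balaban1983to89.Node00.CriticalOnFibreTopGuardedBPrint
import HarnessLib

/-!
# BalabanUVNodes ∕ N12 — THE TWO [15]-THEOREM-1 LETTERS OF N12's (J0′) ROW AT THE INSTANCE's LENGTH, OVER A BOND DATUM `bd` AND A TOP-DATA PREDICATE `Dat`, FROM THE GUARDED ᴮ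
# SENTENCES BY NAME — the print-datum ((γ) ∕ ᴮ) SIBLING of `…N12Thm1LettersAtLengthOfK0GridG` (✓, seat g26), per director-ym №338 ∕ №343 (E1)(iii-b), №365 (siblings, suffix `B`)
# ([Balaban1985Variational] (1) p.277, Thm 1 (2)–(8) pp.278–279, Prop. 8 p.304; [Balaban1984PropagatorsII] (2.3) p.224; [Balaban1988Convergent] (2.1) p.254, (2.5) p.255, (2.12)–(2.13)
# p.256, (2.18) p.257; [Balaban1985RegularSpaces] (1.3)–(1.9) p.77; [Balaban1987RG1] (0.1) p.251; [Balaban1989LargeFieldI] (1.74) p.192, p.193 ll.14–20, Prop. 1 p.194)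

Cell `pub-ymgap` (HUMAN RULINGS D-0062 ∕ D-0149), seat `pub-ymgap-dag-n12-d` g32 (R134 N12 [B15] s2 = by-name knit at the record; count-neutral helper of K1⁹ `stmt-QuantumFields-27364`,
`--kind proof --supports … --as helper`).  THEOREMS ONLY (0 `def`, 0 `instance`, 0 `sorry`); compositions BY NAME; imports GREEN on both sides of the Stage-2 seam (`Node00/Record13CoP`)
— none of `…K0V22ZDefs` ∕ `…K0V23Defs` ∕ `…K0Stub1BHolds` ∕ `…N12AtRecord13*` is imported (import closure outside the seam's cone).

WHY A SIBLING.  The parent `…N12Thm1LettersAtLengthOfK0GridG` reads the (b)-datum tokens `Node00.VariationalThm1RegSepCoP7MG` ∕ the house-shape (E∕U) sentence over `genSet s.Ω k`, and its §3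
imports `…K0V22ZDefs` (on the (b)-datum closure `…K0AllTorusOfStepTokensGuardedZB`, RESIDUE after the seam: def-R `S2-BLAST-RADIUS` v3∕v4, `red_end_v4.txt`).  After FLAG №16 ∕ ruling (α)
(the record's determining-set datum `bondsOf (genSet …)` = reading (b) ≠ print's [II] (2.3) `Λ = ⋃ⱼ Λⱼ(B(Ωⱼ))`), the [15] tokens were re-typed OVER A BOND DATUM `bd : Node00.BondDatum F` and a
TOP-DATA PREDICATE `Dat : Node00.TopData F N` (F0c `Node00.VariationalThm1RegSepCoP7MGB`, `B11Thm1ExistsUniqueTokensGB.VariationalThm1EUSepCoP7MGB`, K0⁷ V23 `K0V23Defs.Prop8StepCoPGridGBAt`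
at `(Node00.lamDatum F, Node00.dataSmall7LamTopOf F 2)`), and dag-n12-c's AT-LENGTH knit row `B15Prop1Thm1RowsOfExistsUniqueAtLengthB.thm1Rows_atZ_of_thm1TorusClass_existsUnique_atLengthB`
displays the two [15]-Theorem-1 letters `h15T` ∕ `h15EUT` over a bond-datum family `bd (k i) ·` READ AT EACH INSTANCE's OWN LENGTH.  THIS FILE serves those two letters, over ANY `(bd, Dat)`,
from the guarded ᴮ sentences — the parent's §1–§3 with ONE substitution of currency (`IsMinimizer … (genSet s.Ω k) ↦ IsMinimizerB … (bd Kt k s.Ω)`, `Sect2.DataSmall7PTop … ↦ Dat Kt s.Ω …`,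
`bondsOf (genSet s.Ω k j) ↦ bd Kt k s.Ω j`), proofs VERBATIM (the reindexing device `exists_seq_reindex_Ω` ∕ `seqSeparated_iff_of_Ω_eq` along the DEGENERATE HISTORY `(M, g) := (ν.M₁, 1)`
where NODE 00's class of record IS the torus class, `DOfRecord_at_flat`; every reader of the ᴮ bodies reads `s.Ω` only).

CONTENTS.  §1 (8): `thm1LetterT_atLength_of_variationalThm1RegSepCoP7MGB` (generic guard `Adm`, one displayed row `hadm` «the guard holds at this instance's degenerate prefix») · `…_grid`
(K0⁷'s four-conjunct grid guard `A‴(c, c₀, c₁)` = the `Adm` of `K0V23Defs.Prop8StepCoPGridGBAt`, TEXT VERBATIM — NOT imported: the rows `c ≤ ν.M₁`, `k + c₀ ≤ m + Kt`, `L^{c₁} ∣ ν.M₁` and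
the instance's divisibility row `LᵏM₁ ∣ sitesPerDir 0` discharge it along `g ≡ 1`, `RkOfRecord_at_flat`) · §2 (E∕U): `thm1LetterEU_atLength_of_variationalThm1EUSepCoP7MGB` (dag-n12-c's
NAMED guard-generic (E∕U) sentence ᴮ — the parent had to inline the house shape; NO producer in the tree at any datum) · `…_grid` · §3 (E∕U)ᴮ at `A‴` from (R)ᴮ + STEPᴮ ∕ SUPPLY(1)ᴮ ∕
LIFTᴮ (dag-n12-c's induction `variationalThm1EUSepCoP7MGB_of_step_of_reg_of_base_of_lift`, truncation row = `A‴` is truncation-stable, a `private` copy of the residue module's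
`gridGuard_of_succ` per №366 R2) · §4 ★★ `exists_thm1LetterT_atLength_lamDatum_of_prop8StepCoPGridGB`: from the BODY of K0⁷'s V23 stub-1ᴮ text `K0V23Defs.Prop8StepCoPGridGBAt F`
(`∃ c c₀ c₁ B₃ a₀ a₁, 2L² ≤ B₃ ∧ 0 < a₀ ∧ 0 < a₁ ∧ Prop8RegSepTopStepGB F 2 suppDomOfRecord A‴ (lamDatum F) Dat B₃ a₀ a₁`, ANY `Dat`; stated on the body so that no module of the
seam's cone is imported — the by-name one-liner `(h1 : K0V23Defs.Prop8StepCoPGridGBAt F)` and its hypothesis-free discharge by `K0Stub1BHolds.prop8StepCoPGridGBAt_holds` (✓, S1c) follow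
in a separate module once the seam cone is re-fed), through k0-s1-w1's 53′ `variationalThm1RegSepCoP7MGB_of_prop8TopStepGB_lamDatum`: the at-length (8)-letter AT PRINT's DATUM
`bd Kt k Ω := Node00.lamDatum F Kt k Ω = lamBondsSeq Ω k` for every `(ν, Kt, k)` passing `A‴`'s rows (the (E∕U) side composes
§3 ∘ §2 `_grid` at the same constants) · §5 the `DataSmall7PTop`-ROW editions (dag-n12-c's (7) row VERBATIM) at print's (7) predicate `Dat := Node00.dataSmall7LamTopOf F 2` through P0's
`dataSmall7LamTopOf_of_dataSmall7PTopOf` (`k ≤ m + Kt` from the level guard, `s.Ω (k+1) = ∅`, block saturation of the torus class `blockSat_torusClassSeq`): `…_pTop_…_lamTop_grid` ×2 and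
★★ `exists_thm1LetterT_atLength_lamDatum_pTop_of_prop8StepCoPGridGB` (from the stub-1ᴮ body at EXACTLY V23's currency `(lamDatum F, dataSmall7LamTopOf F 2)`).

HONEST FRAMING ∕ LOCATED.  Pure bookkeeping over landed ᴮ tokens: every [15] sentence is a HYPOTHESIS here (§4's stub body included), never asserted; the (E∕U)ᴮ sentence and the three
(E∕U) tokens have NO producer in the tree at any datum (orphan edge N07→N12); K0⁷ V23 is NOT registered by this file and stub 1 is read as TEXT; reading a guard-generic sentence at the
degenerate history `g ≡ 1` is an instance of its typed generality, displayed.  The parent module stays landed and true on its own (b)-text.  Nothing of Bałaban's asserted; N12 NOT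
discharged; K0⁷ ∕ K1⁹ NOT closed; counts unmoved (typed 28∕28 · discharged 8∕27, A 8∕28; K 1∕4); R4 closes only the conditional finite-𝕋⁴ rung `BalabanLadder.UV` at fixed
`ε = L^(−K)`; no summit statement is proved here and NOT the Yang–Mills mass gap (Clay); nothing continuum ∕ ℝ⁴ ∕ OS.
-/

noncomputable section

namespace Summit.QuantumFields.YangMills.BalabanUVNodes.N12Thm1LettersAtLengthOfK0GridGB

open scoped Matrix.Norms.L2Operator
open Literature.MathematicalPhysics.QuantumFieldTheory.Balaban1983to89
open T4Continuum B15DeterminingSets GaugeField B15Prop1Carrier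
open B15DeterminingSetsB (BDetSet IsMinimizerB AgreeOnB)
open B16Sect1Backgrounds (toMS)
open B14.Eq213MaximalDomains (side)
open T4CubeChartGnomonic (SU2)
open B15Prop1Thm1GeneralFormShapes (exists_seq_reindex_Ω seqSeparated_iff_of_Ω_eq)
open B15Prop1Thm1RowsOfExistsUnique (DOfRecord_at_flat RkOfRecord_at_flat)
open Node00 (StepGuard SeqOfRecord Stage7Numerics BondDatum TopData lamDatum suppDomOfRecord dCubeSide RkOfRecord VariationalThm1RegSepCoP7MGB Prop8RegSepTopStepGB)
open B11Thm1ExistsUniqueInductionG (truncSeq)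
open B11Thm1ExistsUniqueTokensGB (VariationalThm1EUSepCoP7MGB VariationalThm1EUStepCoP7MGB ApproxMinimiserExistsCoP7MGB VariationalThm1EULiftCoP7MGB
  variationalThm1EUSepCoP7MGB_of_step_of_reg_of_base_of_lift)
open Summit.QuantumFields.YangMills.BalabanUVNodes.N07Thm1Top7FromProp8GuardedB (variationalThm1RegSepCoP7MGB_of_prop8TopStepGB_lamDatum)
open Summit.QuantumFields.YangMills.BalabanUVNodes.N07RecordDomainsAdm22 (blockSat_of_unionsOfCubes_seq)
open Node00 (dataSmall7LamTopOf dataSmall7LamTopOf_of_dataSmall7PTopOf)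
open B5Eq118OneStroke (iterBlockOf)

variable {F : T4Family}

/-! ## §1  The (8)-letter at the instance's length, over `(bd, Dat)`, from the guard-generic ᴮ (8)-sentence -/

/-- ★ **THE (8)-LETTER OF N12's (J0′) ROW AT LENGTH `k`, OVER A BOND DATUM `bd` AND A TOP-DATA PREDICATE `Dat`, FROM THE GUARD-GENERIC ᴮ (8)-SENTENCE**
`Node00.VariationalThm1RegSepCoP7MGB F 2 Adm bd Dat B₃ a₀ a₁` ([15] Thm 1 (R) for `bd`-minimisers over class (6) on the support of record, every numerics ∕ cube letter ∕ coupling history ∕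
torus ∕ length ∕ separated (2.18) index of record PASSING THE PREFIX GUARD `Adm`, data row `Dat`), READ ALONG THE DEGENERATE HISTORY `(M, g) := (ν.M₁, 1)` at torus `Kt` and length `k`:
there NODE 00's class of record IS the torus class of `LʲM₁`-cube unions (`DOfRecord_at_flat`), every torus-class index re-indexes into it along its `Ω`-sequence (`exists_seq_reindex_Ω`;
every reader of the body — `Dat Kt s.Ω …`, `bd Kt k s.Ω`, the classes — reads `s.Ω` only), and the guard is asked ONCE as the displayed row `hadm`.  Conclusion = the `h15T` letter of
`B15Prop1Thm1RowsOfExistsUniqueAtLengthB` at `k i := k` with `bd (k i) Ω := bd Kt k Ω` and the data row `Dat` (there: `Node00.dataSmall7PTopOf F 2`, by `Iff.rfl`).  The (γ) sibling of the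
parent's §1; pure bookkeeping; the sentence stays a HYPOTHESIS. [cite: Balaban1985Variational, (1) p.277, Thm 1 (2),(3),(5),(6),(7)–(8) pp.278–279, p.304 lines 1–2; Balaban1984PropagatorsII, (2.3) p.224; Balaban1988Convergent, (2.1) p.254, (2.5) p.255, (2.12)–(2.13) p.256, (2.18) p.257; Balaban1985RegularSpaces, (1.3)–(1.9) p.77; Balaban1987RG1, (0.1) p.251 (bookkeeping)] -/
theorem thm1LetterT_atLength_of_variationalThm1RegSepCoP7MGB {Adm : StepGuard F} {bd : BondDatum F} {Dat : TopData F 2} {B₃ a₀ a₁ : ℝ}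
    (h15 : VariationalThm1RegSepCoP7MGB F 2 Adm bd Dat B₃ a₀ a₁)
    (ν : Stage7Numerics) (Kt k : ℕ) (hadm : ∀ s₁ : SeqOfRecord F ν ν.M₁ (fun _ => (1 : ℝ)) Kt k, Adm ν ν.M₁ (fun _ => (1 : ℝ)) Kt k s₁) :
    ∀ (s : B14.Eq218Concrete.Seq (fun n : ℕ => Node00.unionsOfCubes (F.P Kt) (side (F.P Kt).L ν.M₁ n)) k),
      Node00.Sect2.SeqSeparated ν.M₁ s → 0 < ν.M₁ →
      ∀ (ε₀ : ℝ) (δ : ℕ → ℝ), (∀ j, j ≤ k → 0 < δ j ∧ δ j ≤ a₁ ∧ B₃ * δ j ≤ ε₀) → (∀ j, j < k → δ j ≤ 2 * δ (j + 1)) →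
      (∀ j, j < k → δ (j + 1) ≤ 2 * δ j) → ε₀ ≤ a₀ →
      ∀ W : MSField (F.P Kt) SU2, Dat Kt s.Ω (suppDomOfRecord F ν Kt s.Ω) k δ W →
        ∀ U₀ : GaugeField (F.P Kt) 0 SU2, IsMinimizerB (Node00.avOfRecord F 2 Kt)
            {U | (∀ j, j ≤ k → PlaqSmallOn (Node00.Sect2.omegaPlaqsTop s.Ω (suppDomOfRecord F ν Kt s.Ω) j) (ε₀ * (F.P Kt).eta j ^ 2) U) ∧
              Node00.Sect2.CoDivClassOnTop s.Ω (suppDomOfRecord F ν Kt s.Ω) k ε₀ U}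
            (bd Kt k s.Ω) W U₀ →
          (∀ j, j ≤ k → PlaqSmallOn (Node00.Sect2.omegaPlaqsTop s.Ω (suppDomOfRecord F ν Kt s.Ω) j) (B₃ * δ j * (F.P Kt).eta j ^ 2) U₀) ∧
            ∀ j, j ≤ k → Node00.Sect2.CoDivSmallOn (Node00.Sect2.omegaBondsTop s.Ω (suppDomOfRecord F ν Kt s.Ω) j) (B₃ * δ j * (F.P Kt).eta j ^ 3) U₀ := by
  intro s hsep hM₁
  obtain ⟨s', hΩ, -⟩ := exists_seq_reindex_Ω s (Node00.DOfRecord F ν ν.M₁ (fun _ => (1 : ℝ)) Kt) fun j h1 hj => by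
    rw [DOfRecord_at_flat]; exact s.chain.memΩ j h1 hj
  have h := h15 ν ν.M₁ (fun _ => (1 : ℝ)) Kt k s' ((seqSeparated_iff_of_Ω_eq ν.M₁ hΩ).2 hsep) hM₁ (hadm s')
  rw [hΩ] at h
  exact h

/-- ★ **THE SAME AT K0⁷'s GRID GUARD** — the four-conjunct guard `A‴(c, c₀, c₁)` of `K0V23Defs.Prop8StepCoPGridGBAt` (text VERBATIM; = V22-Z's): the row `hadm` IS the numerics floor
`c ≤ ν.M₁`, the level guard `k + c₀ ≤ m + Kt`, the granularity `L^{c₁} ∣ ν.M₁`, and — for the fourth conjunct (torus-compatibility of the `𝐃_i`-partitions, `1 ≤ i ≤ k`) — the instance's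
own divisibility row `LᵏM₁ ∣ sitesPerDir 0`: along `g ≡ 1` the (2.5) factor is `R_i(1) = 1` (`RkOfRecord_at_flat`) and `dCubeSide L M₁ 1 i = LⁱM₁` divides `LᵏM₁`.
[cite: Balaban1985Variational, Thm 1 (8) p.279, p.304 lines 1–2; Balaban1985RegularSpaces, (1.3)–(1.6) p.77; Balaban1988Convergent, (2.1) p.254, (2.5) p.255, (2.17)–(2.18) p.257; Balaban1987RG1, (0.1) p.251 (bookkeeping)] -/
theorem thm1LetterT_atLength_of_variationalThm1RegSepCoP7MGB_grid {c c₀ c₁ : ℕ} {bd : BondDatum F} {Dat : TopData F 2} {B₃ a₀ a₁ : ℝ}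
    (h15 : VariationalThm1RegSepCoP7MGB F 2
      (fun ν M g K k _s => c ≤ ν.M₁ ∧ k + c₀ ≤ F.m + K ∧ F.L ^ c₁ ∣ M ∧
        ∀ i, 1 ≤ i → i ≤ k → dCubeSide (F.P K).L M (RkOfRecord (F.P K).L ν.r (g i)) i ∣ (F.P K).sitesPerDir 0) bd Dat B₃ a₀ a₁)
    (ν : Stage7Numerics) (Kt k : ℕ) (hc : c ≤ ν.M₁) (hkc₀ : k + c₀ ≤ F.m + Kt) (hc₁ : F.L ^ c₁ ∣ ν.M₁)
    (hdiv : side (F.P Kt).L ν.M₁ k ∣ (F.P Kt).sitesPerDir 0) :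
    ∀ (s : B14.Eq218Concrete.Seq (fun n : ℕ => Node00.unionsOfCubes (F.P Kt) (side (F.P Kt).L ν.M₁ n)) k),
      Node00.Sect2.SeqSeparated ν.M₁ s → 0 < ν.M₁ →
      ∀ (ε₀ : ℝ) (δ : ℕ → ℝ), (∀ j, j ≤ k → 0 < δ j ∧ δ j ≤ a₁ ∧ B₃ * δ j ≤ ε₀) → (∀ j, j < k → δ j ≤ 2 * δ (j + 1)) →
      (∀ j, j < k → δ (j + 1) ≤ 2 * δ j) → ε₀ ≤ a₀ →
      ∀ W : MSField (F.P Kt) SU2, Dat Kt s.Ω (suppDomOfRecord F ν Kt s.Ω) k δ W →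
        ∀ U₀ : GaugeField (F.P Kt) 0 SU2, IsMinimizerB (Node00.avOfRecord F 2 Kt)
            {U | (∀ j, j ≤ k → PlaqSmallOn (Node00.Sect2.omegaPlaqsTop s.Ω (suppDomOfRecord F ν Kt s.Ω) j) (ε₀ * (F.P Kt).eta j ^ 2) U) ∧
              Node00.Sect2.CoDivClassOnTop s.Ω (suppDomOfRecord F ν Kt s.Ω) k ε₀ U}
            (bd Kt k s.Ω) W U₀ →
          (∀ j, j ≤ k → PlaqSmallOn (Node00.Sect2.omegaPlaqsTop s.Ω (suppDomOfRecord F ν Kt s.Ω) j) (B₃ * δ j * (F.P Kt).eta j ^ 2) U₀) ∧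
            ∀ j, j ≤ k → Node00.Sect2.CoDivSmallOn (Node00.Sect2.omegaBondsTop s.Ω (suppDomOfRecord F ν Kt s.Ω) j) (B₃ * δ j * (F.P Kt).eta j ^ 3) U₀ :=
  thm1LetterT_atLength_of_variationalThm1RegSepCoP7MGB h15 ν Kt k fun _ => ⟨hc, hkc₀, hc₁, fun i _ hi => by
    show dCubeSide (F.P Kt).L ν.M₁ (RkOfRecord (F.P Kt).L ν.r 1) i ∣ (F.P Kt).sitesPerDir 0
    rw [RkOfRecord_at_flat]
    refine Dvd.dvd.trans ?_ hdiv
    show (F.P Kt).L ^ i * ν.M₁ * 1 ∣ (F.P Kt).L ^ k * ν.M₁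
    rw [Nat.mul_one]
    exact Nat.mul_dvd_mul_right (pow_dvd_pow _ hi) _⟩

/-! ## §2  The existence ∕ uniqueness letter at the instance's length, over `(bd, Dat)`, from dag-n12-c's NAMED guard-generic (E∕U)ᴮ sentence -/

/-- ★ **THE (E∕U)-LETTER OF N12's (J0′) ROW AT LENGTH `k ≥ 1`, OVER `(bd, Dat)`, FROM THE NAMED GUARD-GENERIC (E∕U)ᴮ SENTENCE**
`B11Thm1ExistsUniqueTokensGB.VariationalThm1EUSepCoP7MGB F 2 Adm bd Dat B₃ a₀ a₁` ([15] Thm 1: EXISTENCE of a `bd`-minimiser over class (6) at `ε₀` ∧ UNIQUENESS modulo gauges with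
equal, tower-central scale-`j` images at the two ends of every bond of `bd … j`, every separated (2.18) index of POSITIVE length passing `Adm`; NO producer in the tree at any datum),
READ ALONG THE DEGENERATE HISTORY at `(ν, Kt, k)` with the guard row `hadm`.  Conclusion = the `h15EUT` letter of `B15Prop1Thm1RowsOfExistsUniqueAtLengthB` at `k i := k` over
`bd Kt k ·` with the data row `Dat`, VERBATIM.  The (γ) sibling of the parent's §2 (which had to inline the house shape — the name did not exist then). [cite: Balaban1985Variational, (1) p.277, Thm 1 (2),(3),(4),(5),(6),(7) pp.278–279, p.278 lines 19–20; Balaban1984PropagatorsII, (2.3) p.224; Balaban1988Convergent, (2.1) p.254, (2.5) p.255, (2.12)–(2.13) p.256, (2.18) p.257; Balaban1985RegularSpaces, (1.3)–(1.9) p.77 (bookkeeping)] -/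
theorem thm1LetterEU_atLength_of_variationalThm1EUSepCoP7MGB {Adm : StepGuard F} {bd : BondDatum F} {Dat : TopData F 2} {B₃ a₀ a₁ : ℝ}
    (hEU : VariationalThm1EUSepCoP7MGB F 2 Adm bd Dat B₃ a₀ a₁)
    (ν : Stage7Numerics) (Kt k : ℕ) (hk0 : 0 < k) (hadm : ∀ s₁ : SeqOfRecord F ν ν.M₁ (fun _ => (1 : ℝ)) Kt k, Adm ν ν.M₁ (fun _ => (1 : ℝ)) Kt k s₁) :
    ∀ (s : B14.Eq218Concrete.Seq (fun n : ℕ => Node00.unionsOfCubes (F.P Kt) (side (F.P Kt).L ν.M₁ n)) k),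
      Node00.Sect2.SeqSeparated ν.M₁ s → 0 < ν.M₁ →
      ∀ (ε₀ : ℝ) (δ : ℕ → ℝ), (∀ j, j ≤ k → 0 < δ j ∧ δ j ≤ a₁ ∧ B₃ * δ j ≤ ε₀) → (∀ j, j < k → δ j ≤ 2 * δ (j + 1)) →
      (∀ j, j < k → δ (j + 1) ≤ 2 * δ j) → ε₀ ≤ a₀ →
      ∀ W : MSField (F.P Kt) SU2, Dat Kt s.Ω (suppDomOfRecord F ν Kt s.Ω) k δ W →
        (∃ U₀ : GaugeField (F.P Kt) 0 SU2, IsMinimizerB (Node00.avOfRecord F 2 Kt)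
            {U | (∀ j, j ≤ k → PlaqSmallOn (Node00.Sect2.omegaPlaqsTop s.Ω (suppDomOfRecord F ν Kt s.Ω) j) (ε₀ * (F.P Kt).eta j ^ 2) U) ∧
              Node00.Sect2.CoDivClassOnTop s.Ω (suppDomOfRecord F ν Kt s.Ω) k ε₀ U}
            (bd Kt k s.Ω) W U₀) ∧
        ∀ U₁ U₂ : GaugeField (F.P Kt) 0 SU2,
          IsMinimizerB (Node00.avOfRecord F 2 Kt)
            {U | (∀ j, j ≤ k → PlaqSmallOn (Node00.Sect2.omegaPlaqsTop s.Ω (suppDomOfRecord F ν Kt s.Ω) j) (ε₀ * (F.P Kt).eta j ^ 2) U) ∧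
              Node00.Sect2.CoDivClassOnTop s.Ω (suppDomOfRecord F ν Kt s.Ω) k ε₀ U}
            (bd Kt k s.Ω) W U₁ →
          IsMinimizerB (Node00.avOfRecord F 2 Kt)
            {U | (∀ j, j ≤ k → PlaqSmallOn (Node00.Sect2.omegaPlaqsTop s.Ω (suppDomOfRecord F ν Kt s.Ω) j) (ε₀ * (F.P Kt).eta j ^ 2) U) ∧
              Node00.Sect2.CoDivClassOnTop s.Ω (suppDomOfRecord F ν Kt s.Ω) k ε₀ U}
            (bd Kt k s.Ω) W U₂ →
          ∃ u : GaugeTransf (F.P Kt) 0 SU2,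
            (∀ j, j ≤ k → ∀ b ∈ bd Kt k s.Ω j, toMS u j b.src = toMS u j b.tgt ∧ ∀ g : SU2, toMS u j b.src * g = g * toMS u j b.src) ∧
              gaugeAct u U₁ = U₂ := by
  intro s hsep hM₁
  obtain ⟨s', hΩ, -⟩ := exists_seq_reindex_Ω s (Node00.DOfRecord F ν ν.M₁ (fun _ => (1 : ℝ)) Kt) fun j h1 hj => by
    rw [DOfRecord_at_flat]; exact s.chain.memΩ j h1 hj
  have h := hEU ν ν.M₁ (fun _ => (1 : ℝ)) Kt k s' hk0 ((seqSeparated_iff_of_Ω_eq ν.M₁ hΩ).2 hsep) hM₁ (hadm s')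
  rw [hΩ] at h
  exact h

/-- ★ **THE SAME AT K0⁷'s GRID GUARD** `A‴(c, c₀, c₁)` (rows as in §1's `_grid`). [cite: Balaban1985Variational, Thm 1 (2)–(7) pp.278–279, p.304 lines 1–2; Balaban1985RegularSpaces, (1.3)–(1.6) p.77; Balaban1988Convergent, (2.1) p.254, (2.5) p.255, (2.18) p.257 (bookkeeping)] -/
theorem thm1LetterEU_atLength_of_variationalThm1EUSepCoP7MGB_grid {c c₀ c₁ : ℕ} {bd : BondDatum F} {Dat : TopData F 2} {B₃ a₀ a₁ : ℝ}
    (hEU : VariationalThm1EUSepCoP7MGB F 2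
      (fun ν M g K k _s => c ≤ ν.M₁ ∧ k + c₀ ≤ F.m + K ∧ F.L ^ c₁ ∣ M ∧
        ∀ i, 1 ≤ i → i ≤ k → dCubeSide (F.P K).L M (RkOfRecord (F.P K).L ν.r (g i)) i ∣ (F.P K).sitesPerDir 0) bd Dat B₃ a₀ a₁)
    (ν : Stage7Numerics) (Kt k : ℕ) (hk0 : 0 < k) (hc : c ≤ ν.M₁) (hkc₀ : k + c₀ ≤ F.m + Kt) (hc₁ : F.L ^ c₁ ∣ ν.M₁)
    (hdiv : side (F.P Kt).L ν.M₁ k ∣ (F.P Kt).sitesPerDir 0) :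
    ∀ (s : B14.Eq218Concrete.Seq (fun n : ℕ => Node00.unionsOfCubes (F.P Kt) (side (F.P Kt).L ν.M₁ n)) k),
      Node00.Sect2.SeqSeparated ν.M₁ s → 0 < ν.M₁ →
      ∀ (ε₀ : ℝ) (δ : ℕ → ℝ), (∀ j, j ≤ k → 0 < δ j ∧ δ j ≤ a₁ ∧ B₃ * δ j ≤ ε₀) → (∀ j, j < k → δ j ≤ 2 * δ (j + 1)) →
      (∀ j, j < k → δ (j + 1) ≤ 2 * δ j) → ε₀ ≤ a₀ →
      ∀ W : MSField (F.P Kt) SU2, Dat Kt s.Ω (suppDomOfRecord F ν Kt s.Ω) k δ W →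
        (∃ U₀ : GaugeField (F.P Kt) 0 SU2, IsMinimizerB (Node00.avOfRecord F 2 Kt)
            {U | (∀ j, j ≤ k → PlaqSmallOn (Node00.Sect2.omegaPlaqsTop s.Ω (suppDomOfRecord F ν Kt s.Ω) j) (ε₀ * (F.P Kt).eta j ^ 2) U) ∧
              Node00.Sect2.CoDivClassOnTop s.Ω (suppDomOfRecord F ν Kt s.Ω) k ε₀ U}
            (bd Kt k s.Ω) W U₀) ∧
        ∀ U₁ U₂ : GaugeField (F.P Kt) 0 SU2,
          IsMinimizerB (Node00.avOfRecord F 2 Kt)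
            {U | (∀ j, j ≤ k → PlaqSmallOn (Node00.Sect2.omegaPlaqsTop s.Ω (suppDomOfRecord F ν Kt s.Ω) j) (ε₀ * (F.P Kt).eta j ^ 2) U) ∧
              Node00.Sect2.CoDivClassOnTop s.Ω (suppDomOfRecord F ν Kt s.Ω) k ε₀ U}
            (bd Kt k s.Ω) W U₁ →
          IsMinimizerB (Node00.avOfRecord F 2 Kt)
            {U | (∀ j, j ≤ k → PlaqSmallOn (Node00.Sect2.omegaPlaqsTop s.Ω (suppDomOfRecord F ν Kt s.Ω) j) (ε₀ * (F.P Kt).eta j ^ 2) U) ∧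
              Node00.Sect2.CoDivClassOnTop s.Ω (suppDomOfRecord F ν Kt s.Ω) k ε₀ U}
            (bd Kt k s.Ω) W U₂ →
          ∃ u : GaugeTransf (F.P Kt) 0 SU2,
            (∀ j, j ≤ k → ∀ b ∈ bd Kt k s.Ω j, toMS u j b.src = toMS u j b.tgt ∧ ∀ g : SU2, toMS u j b.src * g = g * toMS u j b.src) ∧
              gaugeAct u U₁ = U₂ :=
  thm1LetterEU_atLength_of_variationalThm1EUSepCoP7MGB hEU ν Kt k hk0 fun _ => ⟨hc, hkc₀, hc₁, fun i _ hi => by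
    show dCubeSide (F.P Kt).L ν.M₁ (RkOfRecord (F.P Kt).L ν.r 1) i ∣ (F.P Kt).sitesPerDir 0
    rw [RkOfRecord_at_flat]
    refine Dvd.dvd.trans ?_ hdiv
    show (F.P Kt).L ^ i * ν.M₁ * 1 ∣ (F.P Kt).L ^ k * ν.M₁
    rw [Nat.mul_one]
    exact Nat.mul_dvd_mul_right (pow_dvd_pow _ hi) _⟩

/-! ## §3  (E∕U)ᴮ at `A‴` from (R)ᴮ + STEPᴮ ∕ SUPPLY(1)ᴮ ∕ LIFTᴮ — the truncation row discharged (the grid guard is truncation-stable) -/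

/-- K0⁷'s grid guard `A‴(c,c₀,c₁)` is truncation-stable (`k + 1 ↦ k`).  A `private` verbatim copy of the residue module `…N12Thm1NamesOfK0GridGStepTokens`'s `gridGuard_of_succ`
(№366 R2: that module sits on the (b)-datum closure and is not imported here). [cite: Balaban1985RegularSpaces, (1.3)–(1.6) p.77; Balaban1988Convergent, (2.18) p.257 (bookkeeping)] -/
private theorem gridGuard_of_succ (c c₀ c₁ : ℕ) (ν : Stage7Numerics) (M : ℕ) (g : ℕ → ℝ) (K k : ℕ)
    (h : c ≤ ν.M₁ ∧ k + 1 + c₀ ≤ F.m + K ∧ F.L ^ c₁ ∣ M ∧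
      ∀ i, 1 ≤ i → i ≤ k + 1 → dCubeSide (F.P K).L M (RkOfRecord (F.P K).L ν.r (g i)) i ∣ (F.P K).sitesPerDir 0) :
    c ≤ ν.M₁ ∧ k + c₀ ≤ F.m + K ∧ F.L ^ c₁ ∣ M ∧
      ∀ i, 1 ≤ i → i ≤ k → dCubeSide (F.P K).L M (RkOfRecord (F.P K).L ν.r (g i)) i ∣ (F.P K).sitesPerDir 0 :=
  ⟨h.1, by have := h.2.1; omega, h.2.2.1, fun i h1 hi => h.2.2.2 i h1 (Nat.le_succ_of_le hi)⟩

/-- ★ **(E∕U)ᴮ AT K0⁷'s GRID GUARD FROM (R)ᴮ + THE THREE (E∕U) TOKENS ᴮ, ON THE SUPPORT OF RECORD, `N = 2`** (any `(bd, Dat)`): dag-n12-c's k-induction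
`variationalThm1EUSepCoP7MGB_of_step_of_reg_of_base_of_lift` at `Adm := A‴(c,c₀,c₁)`, its truncation row discharged.  (The residue module `…N12Thm1NamesOfGridGStepTokensB` states this at
generic `N`; restated here at the `N = 2` of N12's road so that this green module is self-contained — NOT a byte-identical restatement.)  CONDITIONAL (no producer for any (E∕U) token).
[cite: Balaban1985Variational, Thm 1 p.279, (11)–(14) pp.279–280, Prop. 2 p.281; Balaban1984PropagatorsII, (2.3) p.224; Balaban1988Convergent, (2.12) p.256, (2.18) p.257] -/
theorem variationalThm1EUSepCoP7MGB_grid_two_of_step_of_reg_of_base_of_lift (c c₀ c₁ : ℕ) {bd : BondDatum F} {Dat : TopData F 2} {C₁ B₃ a₀ a₁ : ℝ}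
    (hstep : VariationalThm1EUStepCoP7MGB F 2
      (fun ν M g K k _s => c ≤ ν.M₁ ∧ k + c₀ ≤ F.m + K ∧ F.L ^ c₁ ∣ M ∧
        ∀ i, 1 ≤ i → i ≤ k → dCubeSide (F.P K).L M (RkOfRecord (F.P K).L ν.r (g i)) i ∣ (F.P K).sitesPerDir 0) bd Dat C₁ B₃ a₀ a₁)
    (hR : VariationalThm1RegSepCoP7MGB F 2
      (fun ν M g K k _s => c ≤ ν.M₁ ∧ k + c₀ ≤ F.m + K ∧ F.L ^ c₁ ∣ M ∧
        ∀ i, 1 ≤ i → i ≤ k → dCubeSide (F.P K).L M (RkOfRecord (F.P K).L ν.r (g i)) i ∣ (F.P K).sitesPerDir 0) bd Dat B₃ a₀ a₁)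
    (hbase : ApproxMinimiserExistsCoP7MGB F 2
      (fun ν M g K k _s => (c ≤ ν.M₁ ∧ k + c₀ ≤ F.m + K ∧ F.L ^ c₁ ∣ M ∧
        ∀ i, 1 ≤ i → i ≤ k → dCubeSide (F.P K).L M (RkOfRecord (F.P K).L ν.r (g i)) i ∣ (F.P K).sitesPerDir 0) ∧ k = 1) bd Dat C₁ B₃ a₀ a₁)
    (hlift : VariationalThm1EULiftCoP7MGB F 2
      (fun ν M g K k _s => c ≤ ν.M₁ ∧ k + c₀ ≤ F.m + K ∧ F.L ^ c₁ ∣ M ∧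
        ∀ i, 1 ≤ i → i ≤ k → dCubeSide (F.P K).L M (RkOfRecord (F.P K).L ν.r (g i)) i ∣ (F.P K).sitesPerDir 0) bd Dat C₁ B₃ a₀ a₁) :
    VariationalThm1EUSepCoP7MGB F 2
      (fun ν M g K k _s => c ≤ ν.M₁ ∧ k + c₀ ≤ F.m + K ∧ F.L ^ c₁ ∣ M ∧
        ∀ i, 1 ≤ i → i ≤ k → dCubeSide (F.P K).L M (RkOfRecord (F.P K).L ν.r (g i)) i ∣ (F.P K).sitesPerDir 0) bd Dat B₃ a₀ a₁ :=
  variationalThm1EUSepCoP7MGB_of_step_of_reg_of_base_of_lift hstep hR hbase hlift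
    fun ν M g K k _s _ h => gridGuard_of_succ (F := F) c c₀ c₁ ν M g K k h

/-! ## §4  At PRINT's [II] (2.3) datum: the letters from the BODY of K0⁷'s V23 stub-1ᴮ text (+ the three (E∕U) tokens ᴮ) -/

/-- ★★ **THE (8)-LETTER OF N12's (J0′) ROW AT PRINT's [II] (2.3) DATUM, FROM THE BODY OF K0⁷'s V23 STUB-1ᴮ TEXT** — `h1` = `K0V23Defs.Prop8StepCoPGridGBAt F` UNFOLDED, with the data
predicate `Dat` generic ([15] Prop. 8's top step at NODE 00's support domains under `A‴(c, c₀, c₁)`, bond datum `Node00.lamDatum F`, constants ∃-bound; V23's registered choice is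
`Dat := Node00.dataSmall7LamTopOf F 2`): for the stub's OWN constants, k0-s1-w1's 53′ `variationalThm1RegSepCoP7MGB_of_prop8TopStepGB_lamDatum` (`0 < B₃` from `2L² ≤ B₃`) gives the
grid-guarded ᴮ (8)-sentence and §1's `_grid` the at-length letter at every `(ν, Kt, k)` passing the three numerics rows and the divisibility row — over the bond-datum family
`bd Kt k Ω := Node00.lamDatum F Kt k Ω` (= `lamBondsSeq Ω k`, the `bd` dag-n12-c's at-length heads are keyed at).  CONDITIONAL on the stub body (K0⁷ stub 1 at print's datum has the
hypothesis-free producer `K0Stub1BHolds.prop8StepCoPGridGBAt_holds` at `Dat := dataSmall7LamTopOf F 2` — composed in a separate module, not importable here inside the seam's cone);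
nothing asserted. [cite: Balaban1985Variational, Thm 1 (6)–(8) pp.278–279, Prop. 8 p.304, p.304 lines 1–2; Balaban1984PropagatorsII, (2.3) p.224; Balaban1985RegularSpaces, (1.3)–(1.6) p.77; Balaban1988Convergent, (2.1) p.254, (2.5) p.255, (2.12) p.256, (2.17)–(2.18) p.257; Balaban1987RG1, (0.1) p.251] -/
theorem exists_thm1LetterT_atLength_lamDatum_of_prop8StepCoPGridGB {Dat : TopData F 2}
    (h1 : ∃ (c c₀ c₁ : ℕ) (B₃ a₀ a₁ : ℝ), 2 * (F.L : ℝ) ^ 2 ≤ B₃ ∧ 0 < a₀ ∧ 0 < a₁ ∧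
      Prop8RegSepTopStepGB F 2 (fun ν K Ω => suppDomOfRecord F ν K Ω)
        (fun ν M g K k _s => c ≤ ν.M₁ ∧ k + c₀ ≤ F.m + K ∧ F.L ^ c₁ ∣ M ∧
          ∀ i, 1 ≤ i → i ≤ k → dCubeSide (F.P K).L M (RkOfRecord (F.P K).L ν.r (g i)) i ∣ (F.P K).sitesPerDir 0) (lamDatum F) Dat B₃ a₀ a₁) :
    ∃ (c c₀ c₁ : ℕ) (B₃ a₀ a₁ : ℝ), 2 * (F.L : ℝ) ^ 2 ≤ B₃ ∧ 0 < a₀ ∧ 0 < a₁ ∧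
    ∀ (ν : Stage7Numerics) (Kt k : ℕ), c ≤ ν.M₁ → k + c₀ ≤ F.m + Kt → F.L ^ c₁ ∣ ν.M₁ → side (F.P Kt).L ν.M₁ k ∣ (F.P Kt).sitesPerDir 0 →
    ∀ (s : B14.Eq218Concrete.Seq (fun n : ℕ => Node00.unionsOfCubes (F.P Kt) (side (F.P Kt).L ν.M₁ n)) k),
      Node00.Sect2.SeqSeparated ν.M₁ s → 0 < ν.M₁ →
      ∀ (ε₀ : ℝ) (δ : ℕ → ℝ), (∀ j, j ≤ k → 0 < δ j ∧ δ j ≤ a₁ ∧ B₃ * δ j ≤ ε₀) → (∀ j, j < k → δ j ≤ 2 * δ (j + 1)) →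
      (∀ j, j < k → δ (j + 1) ≤ 2 * δ j) → ε₀ ≤ a₀ →
      ∀ W : MSField (F.P Kt) SU2, Dat Kt s.Ω (suppDomOfRecord F ν Kt s.Ω) k δ W →
        ∀ U₀ : GaugeField (F.P Kt) 0 SU2, IsMinimizerB (Node00.avOfRecord F 2 Kt)
            {U | (∀ j, j ≤ k → PlaqSmallOn (Node00.Sect2.omegaPlaqsTop s.Ω (suppDomOfRecord F ν Kt s.Ω) j) (ε₀ * (F.P Kt).eta j ^ 2) U) ∧
              Node00.Sect2.CoDivClassOnTop s.Ω (suppDomOfRecord F ν Kt s.Ω) k ε₀ U}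
            (lamDatum F Kt k s.Ω) W U₀ →
          (∀ j, j ≤ k → PlaqSmallOn (Node00.Sect2.omegaPlaqsTop s.Ω (suppDomOfRecord F ν Kt s.Ω) j) (B₃ * δ j * (F.P Kt).eta j ^ 2) U₀) ∧
            ∀ j, j ≤ k → Node00.Sect2.CoDivSmallOn (Node00.Sect2.omegaBondsTop s.Ω (suppDomOfRecord F ν Kt s.Ω) j) (B₃ * δ j * (F.P Kt).eta j ^ 3) U₀ := by
  obtain ⟨c, c₀, c₁, B₃, a₀, a₁, hB₃, ha₀, ha₁, h8⟩ := h1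
  have hL : (1 : ℝ) ≤ F.L := by exact_mod_cast F.hL.2.le
  have hB : 0 < B₃ := lt_of_lt_of_le (by positivity) hB₃
  exact ⟨c, c₀, c₁, B₃, a₀, a₁, hB₃, ha₀, ha₁, fun ν Kt k hc hkc₀ hc₁ hdiv =>
    thm1LetterT_atLength_of_variationalThm1RegSepCoP7MGB_grid (variationalThm1RegSepCoP7MGB_of_prop8TopStepGB_lamDatum hB h8) ν Kt k hc hkc₀ hc₁ hdiv⟩

/-! ## §5  The `DataSmall7PTop`-row editions at print's (7) predicate `Dat := Node00.dataSmall7LamTopOf F 2` (dag-n12-c's (7) row VERBATIM) -/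

/-- **BLOCK SATURATION OF A TORUS-CLASS INDEX** (`s.Ω j` a union of `LʲM₁`-cubes, `1 ≤ j ≤ k ≤ m + K`, `LᵏM₁ ∣ sitesPerDir 0`): membership in `s.Ω j` depends only on the `j`-block point —
dag-n11-a ∕ k0-s1-w1's `blockSat_of_unionsOfCubes_seq` at `c j := LʲM₁`. [cite: Balaban1988Convergent, (2.1)–(2.2) p.254; Balaban1987RG1, (0.1) p.251 (bookkeeping)] -/
theorem blockSat_torusClassSeq (ν : Stage7Numerics) (Kt k : ℕ) (hk : k ≤ (F.P Kt).m + (F.P Kt).K) (hdiv : side (F.P Kt).L ν.M₁ k ∣ (F.P Kt).sitesPerDir 0)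
    (s : B14.Eq218Concrete.Seq (fun n : ℕ => Node00.unionsOfCubes (F.P Kt) (side (F.P Kt).L ν.M₁ n)) k) :
    ∀ (j : ℕ) (x x' : Site (F.P Kt) 0), 1 ≤ j → j ≤ k → iterBlockOf j x = iterBlockOf j x' → x ∈ s.Ω j → x' ∈ s.Ω j :=
  blockSat_of_unionsOfCubes_seq (c := fun j => side (F.P Kt).L ν.M₁ j) hk (fun j h1 hj => s.chain.memΩ j h1 hj)
    (fun j _ hj => by
      refine Dvd.dvd.trans ?_ hdiv
      show (F.P Kt).L ^ j * ν.M₁ ∣ (F.P Kt).L ^ k * ν.M₁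
      exact Nat.mul_dvd_mul_right (pow_dvd_pow _ hj) _)
    fun j _ _ => by
      show (F.P Kt).L ^ j ∣ (F.P Kt).L ^ j * ν.M₁
      exact Dvd.intro _ rfl

/-- ★ **THE (8)-LETTER AT LENGTH `k` WITH THE RECORD's (7) ROW `Sect2.DataSmall7PTop` (dag-n12-c's `h15T` binder VERBATIM over `bd (k) Ω := bd Kt k Ω`), FROM THE GRID-GUARDED ᴮ (8)-SENTENCE
AT PRINT's (7) PREDICATE `Dat := Node00.dataSmall7LamTopOf F 2`** (the `Dat` of K0⁷'s V23 texts): the record's top-domain (7) GIVES print's (P0 `dataSmall7LamTopOf_of_dataSmall7PTopOf`: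
`k ≤ m + Kt` from the level guard, `s.Ω (k+1) = ∅` from the index, block saturation from the torus class ★ above), so §1's `_grid` applies.
[cite: Balaban1985Variational, (3),(7) p.278, Thm 1 (8) p.279, p.304 lines 1–2; Balaban1984PropagatorsII, (2.3) p.224; Balaban1985RegularSpaces, (1.3)–(1.6) p.77; Balaban1988Convergent, (2.1) p.254, (2.5) p.255, (2.12) p.256, (2.17)–(2.18) p.257; Balaban1987RG1, (0.1) p.251 (bookkeeping)] -/
theorem thm1LetterT_atLength_pTop_of_variationalThm1RegSepCoP7MGB_lamTop_grid {c c₀ c₁ : ℕ} {bd : BondDatum F} {B₃ a₀ a₁ : ℝ}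
    (h15 : VariationalThm1RegSepCoP7MGB F 2
      (fun ν M g K k _s => c ≤ ν.M₁ ∧ k + c₀ ≤ F.m + K ∧ F.L ^ c₁ ∣ M ∧
        ∀ i, 1 ≤ i → i ≤ k → dCubeSide (F.P K).L M (RkOfRecord (F.P K).L ν.r (g i)) i ∣ (F.P K).sitesPerDir 0) bd (dataSmall7LamTopOf F 2) B₃ a₀ a₁)
    (ν : Stage7Numerics) (Kt k : ℕ) (hc : c ≤ ν.M₁) (hkc₀ : k + c₀ ≤ F.m + Kt) (hc₁ : F.L ^ c₁ ∣ ν.M₁)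
    (hdiv : side (F.P Kt).L ν.M₁ k ∣ (F.P Kt).sitesPerDir 0) :
    ∀ (s : B14.Eq218Concrete.Seq (fun n : ℕ => Node00.unionsOfCubes (F.P Kt) (side (F.P Kt).L ν.M₁ n)) k),
      Node00.Sect2.SeqSeparated ν.M₁ s → 0 < ν.M₁ →
      ∀ (ε₀ : ℝ) (δ : ℕ → ℝ), (∀ j, j ≤ k → 0 < δ j ∧ δ j ≤ a₁ ∧ B₃ * δ j ≤ ε₀) → (∀ j, j < k → δ j ≤ 2 * δ (j + 1)) →
      (∀ j, j < k → δ (j + 1) ≤ 2 * δ j) → ε₀ ≤ a₀ →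
      ∀ W : MSField (F.P Kt) SU2,
        Node00.Sect2.DataSmall7PTop (Node00.avOfRecord F 2 Kt) s.Ω (suppDomOfRecord F ν Kt s.Ω) k δ W →
        ∀ U₀ : GaugeField (F.P Kt) 0 SU2, IsMinimizerB (Node00.avOfRecord F 2 Kt)
            {U | (∀ j, j ≤ k → PlaqSmallOn (Node00.Sect2.omegaPlaqsTop s.Ω (suppDomOfRecord F ν Kt s.Ω) j) (ε₀ * (F.P Kt).eta j ^ 2) U) ∧
              Node00.Sect2.CoDivClassOnTop s.Ω (suppDomOfRecord F ν Kt s.Ω) k ε₀ U}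
            (bd Kt k s.Ω) W U₀ →
          (∀ j, j ≤ k → PlaqSmallOn (Node00.Sect2.omegaPlaqsTop s.Ω (suppDomOfRecord F ν Kt s.Ω) j) (B₃ * δ j * (F.P Kt).eta j ^ 2) U₀) ∧
            ∀ j, j ≤ k → Node00.Sect2.CoDivSmallOn (Node00.Sect2.omegaBondsTop s.Ω (suppDomOfRecord F ν Kt s.Ω) j) (B₃ * δ j * (F.P Kt).eta j ^ 3) U₀ := by
  intro s hsep hM₁ ε₀ δ hδ h2 h2' hε₀ W hW
  have hk : k ≤ (F.P Kt).m + (F.P Kt).K := by have : (F.P Kt).m + (F.P Kt).K = F.m + Kt := rfl; omega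
  exact thm1LetterT_atLength_of_variationalThm1RegSepCoP7MGB_grid h15 ν Kt k hc hkc₀ hc₁ hdiv s hsep hM₁ ε₀ δ hδ h2 h2' hε₀ W
    (dataSmall7LamTopOf_of_dataSmall7PTopOf (F := F) (N := 2) hk (s.Ω_off (k + 1) (by omega)) (blockSat_torusClassSeq ν Kt k hk hdiv s) hW)

/-- ★ **THE (E∕U)-LETTER AT LENGTH `k ≥ 1` WITH THE RECORD's (7) ROW** (dag-n12-c's `h15EUT` binder VERBATIM over `bd (k) Ω := bd Kt k Ω`), from the grid-guarded (E∕U)ᴮ sentence at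
`Dat := Node00.dataSmall7LamTopOf F 2` — §2's `_grid` through the same (7) bridge.  CONDITIONAL (no producer for the (E∕U)ᴮ sentence at any datum).
[cite: Balaban1985Variational, (3),(7) p.278, Thm 1 (2)–(7) pp.278–279; Balaban1984PropagatorsII, (2.3) p.224; Balaban1985RegularSpaces, (1.3)–(1.6) p.77; Balaban1988Convergent, (2.1) p.254, (2.5) p.255, (2.12) p.256, (2.18) p.257 (bookkeeping)] -/
theorem thm1LetterEU_atLength_pTop_of_variationalThm1EUSepCoP7MGB_lamTop_grid {c c₀ c₁ : ℕ} {bd : BondDatum F} {B₃ a₀ a₁ : ℝ}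
    (hEU : VariationalThm1EUSepCoP7MGB F 2
      (fun ν M g K k _s => c ≤ ν.M₁ ∧ k + c₀ ≤ F.m + K ∧ F.L ^ c₁ ∣ M ∧
        ∀ i, 1 ≤ i → i ≤ k → dCubeSide (F.P K).L M (RkOfRecord (F.P K).L ν.r (g i)) i ∣ (F.P K).sitesPerDir 0) bd (dataSmall7LamTopOf F 2) B₃ a₀ a₁)
    (ν : Stage7Numerics) (Kt k : ℕ) (hk0 : 0 < k) (hc : c ≤ ν.M₁) (hkc₀ : k + c₀ ≤ F.m + Kt) (hc₁ : F.L ^ c₁ ∣ ν.M₁)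
    (hdiv : side (F.P Kt).L ν.M₁ k ∣ (F.P Kt).sitesPerDir 0) :
    ∀ (s : B14.Eq218Concrete.Seq (fun n : ℕ => Node00.unionsOfCubes (F.P Kt) (side (F.P Kt).L ν.M₁ n)) k),
      Node00.Sect2.SeqSeparated ν.M₁ s → 0 < ν.M₁ →
      ∀ (ε₀ : ℝ) (δ : ℕ → ℝ), (∀ j, j ≤ k → 0 < δ j ∧ δ j ≤ a₁ ∧ B₃ * δ j ≤ ε₀) → (∀ j, j < k → δ j ≤ 2 * δ (j + 1)) →
      (∀ j, j < k → δ (j + 1) ≤ 2 * δ j) → ε₀ ≤ a₀ →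
      ∀ W : MSField (F.P Kt) SU2,
        Node00.Sect2.DataSmall7PTop (Node00.avOfRecord F 2 Kt) s.Ω (suppDomOfRecord F ν Kt s.Ω) k δ W →
        (∃ U₀ : GaugeField (F.P Kt) 0 SU2, IsMinimizerB (Node00.avOfRecord F 2 Kt)
            {U | (∀ j, j ≤ k → PlaqSmallOn (Node00.Sect2.omegaPlaqsTop s.Ω (suppDomOfRecord F ν Kt s.Ω) j) (ε₀ * (F.P Kt).eta j ^ 2) U) ∧
              Node00.Sect2.CoDivClassOnTop s.Ω (suppDomOfRecord F ν Kt s.Ω) k ε₀ U}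
            (bd Kt k s.Ω) W U₀) ∧
        ∀ U₁ U₂ : GaugeField (F.P Kt) 0 SU2,
          IsMinimizerB (Node00.avOfRecord F 2 Kt)
            {U | (∀ j, j ≤ k → PlaqSmallOn (Node00.Sect2.omegaPlaqsTop s.Ω (suppDomOfRecord F ν Kt s.Ω) j) (ε₀ * (F.P Kt).eta j ^ 2) U) ∧
              Node00.Sect2.CoDivClassOnTop s.Ω (suppDomOfRecord F ν Kt s.Ω) k ε₀ U}
            (bd Kt k s.Ω) W U₁ →
          IsMinimizerB (Node00.avOfRecord F 2 Kt)
            {U | (∀ j, j ≤ k → PlaqSmallOn (Node00.Sect2.omegaPlaqsTop s.Ω (suppDomOfRecord F ν Kt s.Ω) j) (ε₀ * (F.P Kt).eta j ^ 2) U) ∧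
              Node00.Sect2.CoDivClassOnTop s.Ω (suppDomOfRecord F ν Kt s.Ω) k ε₀ U}
            (bd Kt k s.Ω) W U₂ →
          ∃ u : GaugeTransf (F.P Kt) 0 SU2,
            (∀ j, j ≤ k → ∀ b ∈ bd Kt k s.Ω j, toMS u j b.src = toMS u j b.tgt ∧ ∀ g : SU2, toMS u j b.src * g = g * toMS u j b.src) ∧
              gaugeAct u U₁ = U₂ := by
  intro s hsep hM₁ ε₀ δ hδ h2 h2' hε₀ W hW
  have hk : k ≤ (F.P Kt).m + (F.P Kt).K := by have : (F.P Kt).m + (F.P Kt).K = F.m + Kt := rfl; omega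
  exact thm1LetterEU_atLength_of_variationalThm1EUSepCoP7MGB_grid hEU ν Kt k hk0 hc hkc₀ hc₁ hdiv s hsep hM₁ ε₀ δ hδ h2 h2' hε₀ W
    (dataSmall7LamTopOf_of_dataSmall7PTopOf (F := F) (N := 2) hk (s.Ω_off (k + 1) (by omega)) (blockSat_torusClassSeq ν Kt k hk hdiv s) hW)

/-- ★★ **THE (8)-LETTER OF N12's (J0′) ROW WITH THE RECORD's (7) ROW, AT PRINT's [II] (2.3) DATUM, FROM THE BODY OF K0⁷'s V23 STUB-1ᴮ TEXT AT ITS REGISTERED-TO-BE CURRENCY**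
`(Node00.lamDatum F, Node00.dataSmall7LamTopOf F 2)` — `h1` = `K0V23Defs.Prop8StepCoPGridGBAt F` UNFOLDED, byte for byte: for the stub's own constants, dag-n12-c's `h15T` binder at
`bd (k) Ω := Node00.lamDatum F Kt k Ω` for every `(ν, Kt, k)` passing `A‴`'s rows.  CONDITIONAL on the stub body (hypothesis-free at this exact `Dat` via `K0Stub1BHolds.prop8StepCoPGridGBAt_holds`,
composed in a separate module outside this file's import policy); nothing asserted. [cite: Balaban1985Variational, (3),(7) p.278, Thm 1 (6)–(8) pp.278–279, Prop. 8 p.304, p.304 lines 1–2; Balaban1984PropagatorsII, (2.3) p.224; Balaban1985RegularSpaces, (1.3)–(1.6) p.77; Balaban1988Convergent, (2.1) p.254, (2.5) p.255, (2.12) p.256, (2.17)–(2.18) p.257; Balaban1987RG1, (0.1) p.251] -/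
theorem exists_thm1LetterT_atLength_lamDatum_pTop_of_prop8StepCoPGridGB
    (h1 : ∃ (c c₀ c₁ : ℕ) (B₃ a₀ a₁ : ℝ), 2 * (F.L : ℝ) ^ 2 ≤ B₃ ∧ 0 < a₀ ∧ 0 < a₁ ∧
      Prop8RegSepTopStepGB F 2 (fun ν K Ω => suppDomOfRecord F ν K Ω)
        (fun ν M g K k _s => c ≤ ν.M₁ ∧ k + c₀ ≤ F.m + K ∧ F.L ^ c₁ ∣ M ∧
          ∀ i, 1 ≤ i → i ≤ k → dCubeSide (F.P K).L M (RkOfRecord (F.P K).L ν.r (g i)) i ∣ (F.P K).sitesPerDir 0) (lamDatum F) (dataSmall7LamTopOf F 2) B₃ a₀ a₁) :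
    ∃ (c c₀ c₁ : ℕ) (B₃ a₀ a₁ : ℝ), 2 * (F.L : ℝ) ^ 2 ≤ B₃ ∧ 0 < a₀ ∧ 0 < a₁ ∧
    ∀ (ν : Stage7Numerics) (Kt k : ℕ), c ≤ ν.M₁ → k + c₀ ≤ F.m + Kt → F.L ^ c₁ ∣ ν.M₁ → side (F.P Kt).L ν.M₁ k ∣ (F.P Kt).sitesPerDir 0 →
    ∀ (s : B14.Eq218Concrete.Seq (fun n : ℕ => Node00.unionsOfCubes (F.P Kt) (side (F.P Kt).L ν.M₁ n)) k),
      Node00.Sect2.SeqSeparated ν.M₁ s → 0 < ν.M₁ →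
      ∀ (ε₀ : ℝ) (δ : ℕ → ℝ), (∀ j, j ≤ k → 0 < δ j ∧ δ j ≤ a₁ ∧ B₃ * δ j ≤ ε₀) → (∀ j, j < k → δ j ≤ 2 * δ (j + 1)) →
      (∀ j, j < k → δ (j + 1) ≤ 2 * δ j) → ε₀ ≤ a₀ →
      ∀ W : MSField (F.P Kt) SU2,
        Node00.Sect2.DataSmall7PTop (Node00.avOfRecord F 2 Kt) s.Ω (suppDomOfRecord F ν Kt s.Ω) k δ W →
        ∀ U₀ : GaugeField (F.P Kt) 0 SU2, IsMinimizerB (Node00.avOfRecord F 2 Kt)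
            {U | (∀ j, j ≤ k → PlaqSmallOn (Node00.Sect2.omegaPlaqsTop s.Ω (suppDomOfRecord F ν Kt s.Ω) j) (ε₀ * (F.P Kt).eta j ^ 2) U) ∧
              Node00.Sect2.CoDivClassOnTop s.Ω (suppDomOfRecord F ν Kt s.Ω) k ε₀ U}
            (lamDatum F Kt k s.Ω) W U₀ →
          (∀ j, j ≤ k → PlaqSmallOn (Node00.Sect2.omegaPlaqsTop s.Ω (suppDomOfRecord F ν Kt s.Ω) j) (B₃ * δ j * (F.P Kt).eta j ^ 2) U₀) ∧
            ∀ j, j ≤ k → Node00.Sect2.CoDivSmallOn (Node00.Sect2.omegaBondsTop s.Ω (suppDomOfRecord F ν Kt s.Ω) j) (B₃ * δ j * (F.P Kt).eta j ^ 3) U₀ := by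
  obtain ⟨c, c₀, c₁, B₃, a₀, a₁, hB₃, ha₀, ha₁, h8⟩ := h1
  have hL : (1 : ℝ) ≤ F.L := by exact_mod_cast F.hL.2.le
  have hB : 0 < B₃ := lt_of_lt_of_le (by positivity) hB₃
  exact ⟨c, c₀, c₁, B₃, a₀, a₁, hB₃, ha₀, ha₁, fun ν Kt k hc hkc₀ hc₁ hdiv =>
    thm1LetterT_atLength_pTop_of_variationalThm1RegSepCoP7MGB_lamTop_grid (variationalThm1RegSepCoP7MGB_of_prop8TopStepGB_lamDatum hB h8) ν Kt k hc hkc₀ hc₁ hdiv⟩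

end Summit.QuantumFields.YangMills.BalabanUVNodes.N12Thm1LettersAtLengthOfK0GridGB

end
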